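import Summits.QuantumFields.YangMills.Theorems.BalabanUVNodesN19CoreSkewProduct

/-!
# BalabanUVNodes ∕ N19 (NE7) — THE PRODUCT CALCULUS OF THE HYBRID NE7 DATUM, IV: FINITE PRODUCTS OF MATCHED FACTORS ON ONE INDEX
# («SCALE CHAINS») — a term matched factor by factor, each factor with its own bad class and radius, is matched with the UNION of the
# bad classes and the SUM of the radii; with per-step radii «small at birth, contracted since» (`inj K j · ρ^{K−j}`, the tree's
# `T4CauchySum.InjectedRate` ∕ `delta` currency) the chain radius IS `T4CauchySum.delta 1 ρ inj K`, hence SUMMABLE — N19's ∃δ-edge shape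

Cell `pub-ymgap` (HUMAN RULING D-0062 Track A; D-0149 width push, director-ym №197), seat `pub-ymgap-dag-n19-w2` (WIDTH SEAT 2 of 3 on
NODE n19 = NE7) gen 2.  Filed `--kind proof --supports stmt-QuantumFields-20544 --as helper` (K3⁷ `SpineGivenEndpointR13SepCoPH`);
COUNT-NEUTRAL.  Files I–III = `…N19CoreProductBlocks` (p593172) ∕ `…N19CoreProductBlockFamily` (p594080) ∕ `…N19CoreSkewProduct`.

WHY THIS FILE.  In [Balaban1988Convergent] (2.18)'s expansion a term is a HISTORY and its weight is a product over the SCALES `j < K` of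
conditional step factors (file III's skew-product reading, iterated).  Read on the common index of histories, a scale-by-scale two-run
matching is a finite family of matched FACTOR data `(P_j, Q_j, Bad_j, δ_j)` on ONE class family `T K`, the factor set `s K` depending on
the number of steps `K`.  What is typed:
* §1 ★ `core_finsetProd_of_levelwise` ∕ `core_finsetProd` — at each level the ACTIVE factors `j ∈ s K` sandwiched with class-uniform constants (resp. `∀ j, Core l₀ (vol j) T (Bad j) (P j) (Q j) (δ j)`), run A's good factors nonnegative ⟹
  `Core l₀ 1 T (⋃_{j ∈ s K} Bad j) (∏_{j ∈ s K} P j) (∏_{j ∈ s K} Q j) (Σ_{j ∈ s K} vol_j·δ_j)` — `T4HybridMatching.prod_sandwich` BY NAME at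
  each good point with the factors' class-uniform constants (the n-ary, `K`-dependent sibling of file III's `core_mul`); `mem_good_biUnion_iff`;
* §2 THE TWO-RATE CHAIN — per-step radii `inj K j · ρ^{K − j}` («discrepancy injected at scale `j`, small at birth through
  `InjectedRate C c θ inj`, contracted by `ρ` per later scale» — node U4′'s currency `T4CauchySum.delta`): `sum_range_succ_eq_delta`
  (`Σ_{j ≤ K} inj K j · ρ^{K−j} = delta 1 ρ inj K`, `Finset.Nat.sum_antidiagonal_eq_sum_range_succ`), ★★ `coreEdge_scaleChain` —
  the factorwise matchings over `s K := range (K + 1)` compose to N19's ∃δ-EDGE SHAPE `∃ δ, Core … δ ∧ Summable δ` with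
  `δ := delta 1 ρ inj` (`T4CauchySum.summable_delta` BY NAME; `θ, ρ ∈ [0, 1[`);
* §3 `not_summable_chainRadius_of_const_birth` — the located CAVEAT in the same currency ([GawedzkiKupiainen1985] (142)–(143) p.20 as
  quoted in `T4MatchingAssembly` (4): «the marginal discrepancy does not contract, summability needs smallness at birth»): per-step radii
  `a · ρ^{K−j}` with a birth size `a > 0` NOT decaying in `j` give chain radii `≥ a` for every `K`, hence NOT summable — contraction
  alone never produces the edge.
All [folklore] finite-sum ∕ series bookkeeping; nothing of Bałaban's is instantiated.

HONEST FRAMING.  Count-neutral kernel bookkeeping; ZERO estimate content — that Bałaban's conditional step factors of the two runs ARE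
matched with history-uniform constants at radii `inj K j · ρ^{K−j}` is the conjunction NE2–NE6 ⟹ NE7 of the T⁴ spine, NOT PRINTED for
d = 4 and NOT proved ([Balaban1989LargeFieldII] p.356; [King1986] (3.9)–(3.13) is the d = 2,3 abelian template); N19 NOT discharged;
K3⁷ OPEN, not claimed; counts UNMOVED (typed 28∕28 · discharged 5∕27 (A 5∕28)); no count claim.  One finite 𝕋⁴ programme at fixed ε,
Bałaban AS PRINTED; the YM mass gap (Clay) is NOT proved by any of this — R4 closes the conditional finite-𝕋⁴ rung `BalabanLadder.UV`
only; nothing continuum ∕ ℝ⁴ ∕ OS.  No `def`, no `instance`, no `sorry`.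
-/

noncomputable section

namespace Summit.QuantumFields.YangMills.BalabanUVNodes.N19CoreScaleChain

open Literature.MathematicalPhysics.QuantumFieldTheory.Balaban1983to89
open T4HybridMatching T4WeightBudget T4MatchingAssembly T4CauchySum
open Summit.QuantumFields.BalabanUV.T4Continuum.Spine
open scoped BigOperators

/-! ## §1 FINITE PRODUCTS OF MATCHED FACTORS ON ONE INDEX -/

section FinsetProd

variable {ι : Type*} [DecidableEq ι] {J : Type*} {l₀ : ℝ} {T : ℕ → Finset ι} {vol : J → ℝ}
  {Bad : J → ℕ → ℝ → Finset ι} {P Q : J → ℕ → ℝ → ι → ℝ} {δ : J → ℕ → ℝ}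

/-- a point is good for the UNION of the factors' bad classes iff it is good for each factor. [folklore] -/
theorem mem_good_biUnion_iff {S : Finset ι} {s : Finset J} {G : J → Finset ι} {τ : ι} :
    τ ∈ S \ s.biUnion G ↔ τ ∈ S ∧ ∀ j ∈ s, τ ∈ S \ G j := by
  simp only [Finset.mem_sdiff, Finset.mem_biUnion, not_exists, not_and]
  exact ⟨fun h => ⟨h.1, fun j hj => ⟨h.1, h.2 j hj⟩⟩, fun h => ⟨h.1, fun j hj => (h.2 j hj).2⟩⟩

/-- **`Core` OF A FINITE PRODUCT OF MATCHED FACTORS, LEVELWISE HYPOTHESIS** (factor set `s K` may depend on `K`; only the factors ACTIVE at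
level `K` are asked anything at level `K`): if at every level `K` each active factor `j ∈ s K` is sandwiched on its good class `T K ∖ Bad j K t` with
ONE `t`- and class-independent constant at radius `vol_j·δ_j K`, run A's good factors nonnegative, then the product weights are matched with the UNION
of the active bad classes, constants `Σ_j c_j` and radius `Σ_{j ∈ s K} vol_j·δ_j K` (at `vol := 1`) — `T4HybridMatching.prod_sandwich` at every good point.
[folklore] -/
theorem core_finsetProd_of_levelwise (s : ℕ → Finset J)
    (h : ∀ K, ∀ j ∈ s K, ∃ c : ℝ, ∀ t : ℝ, |t| ≤ l₀ → ∀ τ ∈ T K \ Bad j K t,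
      Real.exp (c - vol j * δ j K) * P j K t τ ≤ Q j K t τ ∧ Q j K t τ ≤ Real.exp (c + vol j * δ j K) * P j K t τ)
    (hP : ∀ K, ∀ j ∈ s K, ∀ t, |t| ≤ l₀ → ∀ τ ∈ T K \ Bad j K t, 0 ≤ P j K t τ) :
    NE7.Core l₀ 1 T (fun K t => (s K).biUnion fun j => Bad j K t) (fun K t τ => ∏ j ∈ s K, P j K t τ)
      (fun K t τ => ∏ j ∈ s K, Q j K t τ) (fun K => ∑ j ∈ s K, vol j * δ j K) := by
  classical
  intro K
  -- one constant per active factor (junk `0` off `s K`, never read)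
  have hc : ∀ j, ∃ c : ℝ, j ∈ s K → ∀ t : ℝ, |t| ≤ l₀ → ∀ τ ∈ T K \ Bad j K t,
      Real.exp (c - vol j * δ j K) * P j K t τ ≤ Q j K t τ ∧ Q j K t τ ≤ Real.exp (c + vol j * δ j K) * P j K t τ := fun j => by
    by_cases hj : j ∈ s K
    · obtain ⟨c, hc⟩ := h K j hj
      exact ⟨c, fun _ => hc⟩
    · exact ⟨0, fun h' => absurd h' hj⟩
  choose c hc using hc
  refine ⟨∑ j ∈ s K, c j, fun t ht τ hτ => ?_⟩
  have hgood : ∀ j ∈ s K, τ ∈ T K \ Bad j K t := (mem_good_biUnion_iff.1 hτ).2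
  have hsw := prod_sandwich (s K) (φ := fun j => P j K t τ) (ψ := fun j => Q j K t τ) (c := c)
    (r := fun j => vol j * δ j K) (fun j hj => hP K j hj t ht τ (hgood j hj)) (fun j hj => (hc j hj t ht τ (hgood j hj)).1)
    fun j hj => (hc j hj t ht τ (hgood j hj)).2
  simpa only [one_mul] using hsw

/-- **`Core` OF A FINITE PRODUCT OF MATCHED FACTORS** (each factor a matched datum at ALL levels, `Core l₀ (vol j) T (Bad j) (P j) (Q j) (δ j)`; the
`K`-independent-factor-data case of `core_finsetProd_of_levelwise`): the n-ary, `K`-dependent sibling of file III's `core_mul`. [folklore] -/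
theorem core_finsetProd (s : ℕ → Finset J) (h : ∀ j, NE7.Core l₀ (vol j) T (Bad j) (P j) (Q j) (δ j))
    (hP : ∀ j K t, |t| ≤ l₀ → ∀ τ ∈ T K \ Bad j K t, 0 ≤ P j K t τ) :
    NE7.Core l₀ 1 T (fun K t => (s K).biUnion fun j => Bad j K t) (fun K t τ => ∏ j ∈ s K, P j K t τ)
      (fun K t τ => ∏ j ∈ s K, Q j K t τ) (fun K => ∑ j ∈ s K, vol j * δ j K) :=
  core_finsetProd_of_levelwise s (fun K j _ => h j K) fun K j _ t ht τ hτ => hP j K t ht τ hτ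

end FinsetProd

/-! ## §2 THE TWO-RATE CHAIN: per-step radii `inj K j · ρ^{K−j}` compose to the SUMMABLE chain radius `delta 1 ρ inj K` -/

section Chain

variable {ι : Type*} [DecidableEq ι] {l₀ ρ θ C : ℝ} {c : ℕ} {T : ℕ → Finset ι} {Bad : ℕ → ℕ → ℝ → Finset ι}
  {P Q : ℕ → ℕ → ℝ → ι → ℝ} {inj : ℕ → ℕ → ℝ}

/-- the chain radius in node U4′'s currency: `Σ_{j ∈ range (K+1)} inj K j · ρ^{K − j} = T4CauchySum.delta 1 ρ inj K`. [folklore] -/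
theorem sum_range_succ_eq_delta (ρ : ℝ) (inj : ℕ → ℕ → ℝ) (K : ℕ) :
    ∑ j ∈ Finset.range (K + 1), inj K j * ρ ^ (K - j) = delta 1 ρ inj K := by
  unfold delta
  rw [one_mul, Finset.Nat.sum_antidiagonal_eq_sum_range_succ (fun j n => inj K j * ρ ^ n) K]

/-- **THE SCALE CHAIN COMPOSES TO N19's ∃δ-EDGE SHAPE.**  At every level `K` the steps `j ≤ K` (factor set `range (K + 1)`) are each sandwiched on
the common index with their own bad class, ONE class-uniform constant and radius `inj K j · ρ^{K − j}` («injected at scale `j`, contracted by `ρ` per later scale»;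
`j ≤ K`, so `K − j` is an honest difference), run A's good factors nonnegative, the birth sizes an `InjectedRate C c θ inj`, `θ, ρ ∈ [0, 1[` ⟹
`∃ δ, Core l₀ 1 T (⋃_{j ≤ K} Bad j) (∏_{j ≤ K} P j) (∏_{j ≤ K} Q j) δ ∧ Summable δ`, witness `δ := T4CauchySum.delta 1 ρ inj` (`core_finsetProd_of_levelwise` +
`sum_range_succ_eq_delta` + `T4CauchySum.summable_delta` BY NAME). [folklore] -/
theorem coreEdge_scaleChain
    (h : ∀ K j, j ≤ K → ∃ c : ℝ, ∀ t : ℝ, |t| ≤ l₀ → ∀ τ ∈ T K \ Bad j K t,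
      Real.exp (c - inj K j * ρ ^ (K - j)) * P j K t τ ≤ Q j K t τ ∧ Q j K t τ ≤ Real.exp (c + inj K j * ρ ^ (K - j)) * P j K t τ)
    (hP : ∀ K j, j ≤ K → ∀ t, |t| ≤ l₀ → ∀ τ ∈ T K \ Bad j K t, 0 ≤ P j K t τ)
    (hinj : InjectedRate C c θ inj) (hθ : 0 ≤ θ) (hθ1 : θ < 1) (hρ : 0 ≤ ρ) (hρ1 : ρ < 1) :
    ∃ δ : ℕ → ℝ, NE7.Core l₀ 1 T (fun K t => (Finset.range (K + 1)).biUnion fun j => Bad j K t)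
      (fun K t τ => ∏ j ∈ Finset.range (K + 1), P j K t τ) (fun K t τ => ∏ j ∈ Finset.range (K + 1), Q j K t τ) δ ∧ Summable δ := by
  refine ⟨delta 1 ρ inj, ?_, summable_delta hinj zero_le_one hθ hθ1 hρ hρ1⟩
  have hle : ∀ {K j}, j ∈ Finset.range (K + 1) → j ≤ K := fun hj => Nat.lt_succ_iff.1 (Finset.mem_range.1 hj)
  have hc := core_finsetProd_of_levelwise (vol := fun _ => (1 : ℝ)) (δ := fun j K => inj K j * ρ ^ (K - j)) (P := P) (Q := Q) (Bad := Bad)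
    (T := T) (l₀ := l₀) (fun K => Finset.range (K + 1))
    (fun K j hj => by simpa only [one_mul] using h K j (hle hj)) fun K j hj => hP K j (hle hj)
  intro K
  obtain ⟨c₀, hc₀⟩ := hc K
  refine ⟨c₀, fun t ht τ hτ => ?_⟩
  have e : ∑ j ∈ Finset.range (K + 1), (1 : ℝ) * (inj K j * ρ ^ (K - j)) = delta 1 ρ inj K := by
    simp only [one_mul]; exact sum_range_succ_eq_delta ρ inj K
  simpa only [e] using hc₀ t ht τ hτ

end Chain

/-! ## §3 THE LOCATED CAVEAT: contraction without smallness at birth gives NO summable chain radius -/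

section Caveat

/-- **[GawedzkiKupiainen1985]'s remark in the chain currency**: per-step radii `a · ρ^{K − j}` with a CONSTANT birth size `a > 0` (no decay
in the scale of injection) have chain radius `Σ_{j ≤ K} a·ρ^{K−j} ≥ a` (the last step alone), so the chain radii do NOT tend to `0` and are
NOT summable — contraction by `ρ` per later scale never produces N19's edge by itself; the smallness must sit at birth (node U2's rates).
[folklore] -/
theorem not_summable_chainRadius_of_const_birth {a ρ : ℝ} (ha : 0 < a) (hρ : 0 ≤ ρ) :
    ¬ Summable fun K => ∑ j ∈ Finset.range (K + 1), a * ρ ^ (K - j) := by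
  intro hs
  have hlim := hs.tendsto_atTop_zero
  have hge : ∀ K, a ≤ ∑ j ∈ Finset.range (K + 1), a * ρ ^ (K - j) := fun K => by
    have hK : K ∈ Finset.range (K + 1) := Finset.mem_range.2 (Nat.lt_succ_self K)
    have := Finset.single_le_sum (f := fun j => a * ρ ^ (K - j)) (fun j _ => mul_nonneg ha.le (pow_nonneg hρ _)) hK
    simpa using this
  have hev := (Filter.Tendsto.eventually_lt_const ha hlim).exists
  obtain ⟨K, hK⟩ := hev
  exact (lt_irrefl a) ((hge K).trans_lt hK)

end Caveat

end Summit.QuantumFields.YangMills.BalabanUVNodes.N19CoreScaleChain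

end
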